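import Literature.AlgebraicGeometry.AbelianSchemes.AbelianSchemePolarizationBaseChange
import Literature.AlgebraicGeometry.Limits.LocalizationRelativeSmoothSpread
import Literature.AlgebraicGeometry.Limits.LocalizationRelativeGroupSpread
import Mathlib.FieldTheory.IsAlgClosed.AlgebraicClosure
import HarnessLib

/-!
# SPREAD SEQUEL (s2-λ), ampleness half: a homomorphism `λ : 𝒜 → Â` over a stage base that is a polarization GENERICALLY is a
# polarization over a FINER STAGE — assembled BY VALUE against «the polarization locus is open» ([GortzWedhorn2023] Cor. 27.285)

Layer `Literature/AlgebraicGeometry/AbelianSchemes`, namespaces `Literature.AlgebraicGeometry.Limits.LocApprox` (§1) and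
`Literature.AlgebraicGeometry.AbelianSchemes.AbelianSchemeOver` (§2–§3).  THEOREMS ONLY (no definition, no named fact, no instance, no
notation, no `sorry`).  Cell `hodgecm-mathlib` (D-0151), FLOOR 0, P6 «MOD programme» (crux hLiu418 = stmt-HodgeConjecture-24832), SPREAD door,
deal «SPREAD SEQUELS», item (s2-λ)-ample (LEAD F0P6-plan (g2) RULING 2026-09-01 22:00:28Z, reading (α): «generic class ample → locus OPEN ∋ η →
finer stage inside → …»; B-p18 (g37)).  The hom half is ★ `AbelianSchemeOverSpreadStageStructure.exists_stage_monHom` (ED. 2).  HC_CM is proved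
only modulo the printed citations until rung 0 closes; this file is generic and changes no count: the openness of the polarization locus enters
BY VALUE (hypothesis `hopen`, the exact shape of [GortzWedhorn2023] Cor. 27.285), to be discharged by the organ «AmpleLocusOpen»
(`ProjectiveGeometry/AmpleLocusOpen`, [EGAIII1] 4.7.1 = [GortzWedhorn2023] Thm. 24.46) + ★ G4 `IsLambdaOfAtSquareRoot` + ★ B10
`LDeltaRigidifiedFibrewiseAmple` along [GortzWedhorn2023] Lemma 27.281 (1), Prop. 27.284, Cor. 27.268.

* §1 **`exists_stage_forall_geometricPoint`** — THE LOCUS-TO-STAGE LEMMA for a condition `Q` on GEOMETRIC POINTS of a stage base `P ⊗ D(t)`: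
  if every point admitting one geometric point with `Q` has an open neighbourhood all of whose geometric points satisfy `Q` (the
  Cor. 27.285 shape), and every geometric point of the generic base `P ⊗ Spec B` satisfies `Q` (through the cone leg), then every geometric
  point of some finer stage `P ⊗ D(s)` satisfies `Q` (through the transition) — ★ `exists_stage_range_fst_subset` applied to the union of the
  good neighbourhoods, which contains the image of the generic base because every point has a geometric point (`Spec` of an algebraic
  closure of its residue field).
* §2 **`exists_polarization_baseChange_of_forall_isLambdaOfAt`** — a homomorphism `λ : A → Â` whose base change along `g : S′ → S` is, at every
  geometric point `z̄` of `S′`, `Λ(𝒪(Θ))` for an ample `Θ` AT `z̄ ≫ g`, base-changes to a POLARIZATION `(λ ×_S S′, Λ(e^*Θ))` of `A ×_S S′`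
  (the proof of ★ `Polarization.baseChange`, pointwise: ★ `IsLambdaOfAt.baseChange`, `IsAmple.pullback`).
* §3 **`exists_stage_polarization_of_isOpen_locus`** — THE (s2-λ)-AMPLE HEAD: `𝒜` an abelian scheme over `P ⊗ D(t)` with dual pair `D` and a
  homomorphism `λ : 𝒜 → Â` which is a polarization at every geometric point of the generic base; under `hopen` (Cor. 27.285 for `λ`, by
  value) there are `ρ : s ⟶ t` and a polarization of `𝒜 ×_{P⊗D(t)} (P ⊗ D(s))` for `D ×_{P⊗D(t)} (P ⊗ D(s))` with `lam = λ ×_{P⊗D(t)} (P ⊗ D(s))`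
  (★ `stageOver` currency of (s1)∕(s3)).

## References
* [GortzWedhorn2023] U. Görtz, T. Wedhorn, *Algebraic Geometry II: Cohomology of Schemes* (2023), Thm. 24.46 (p. 531), Cor. 27.268 (p. 934),
  Def. 27.280, Lemma 27.281, Prop. 27.284, Cor. 27.285 (pp. 948–949).
* [EGAIII1] A. Grothendieck, J. Dieudonné, *EGA III₁* (1961), Thm. 4.7.1.
* [MumfordFogartyKirwan1994] D. Mumford, J. Fogarty, F. Kirwan, *Geometric Invariant Theory*, 3rd ed. (1994), Ch. 6 §2 Def. 6.3 (p. 120),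
  Ch. 7 §2 Def. 7.2 (p. 129).
* [StacksProject] The Stacks Project, Tag 01Z3.
-/

set_option autoImplicit false

noncomputable section

universe u

open CategoryTheory CategoryTheory.Limits AlgebraicGeometry MonoidalCategory CartesianMonoidalCategory
open scoped MonObj

/-! ## §1 The locus-to-stage lemma for conditions on geometric points -/

namespace Literature.AlgebraicGeometry.Limits

namespace LocApprox

open Literature.AlgebraicGeometry.Motives (SchemeOver specOver)

variable {A : Type u} [CommRing A] {S : Submonoid A} (B : Type u) [CommRing B] [Algebra A B] [IsLocalization S B]
  (P : SchemeOver A) [QuasiCompact P.hom]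

/-- **A CONDITION ON GEOMETRIC POINTS WITH OPEN GOOD LOCUS, TRUE ON THE GENERIC BASE, IS TRUE ON A FINER STAGE.**  `Q` a condition on
geometric points of the stage base `P ⊗ D(t)` (`P → Spec A` quasi-compact, `B = A_S`) such that (`hopen`, the shape of [GortzWedhorn2023]
Cor. 27.285) every point `x` having ONE geometric point over it with `Q` has an open neighbourhood `U` with `Q` at EVERY geometric point landing in
`U`, and (`hgen`) `Q` holds at `ȳ ≫ (P ◁ π_t)` for every geometric point `ȳ` of the generic base `P ⊗ Spec B`.  THEN for some `ρ : s ⟶ t`, `Q`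
holds at `z̄ ≫ (P ◁ D(ρ))` for every geometric point `z̄` of `P ⊗ D(s)`: the union `W` of the good neighbourhoods is an open containing the image
of the generic base (a point `y` of `P ⊗ Spec B` carries the geometric point `Spec κ(y)^alg → P ⊗ Spec B`), hence the image of a finer stage
(★ `exists_stage_range_fst_subset`, [StacksProject, Tag 01Z3]). [cite: GortzWedhorn2023, Cor. 27.285 (p. 949)] [cite: StacksProject, Tag 01Z3] -/
theorem exists_stage_forall_geometricPoint {t : Idx S}
    (Q : ∀ (Ω : Type u) [Field Ω] [IsAlgClosed Ω], (Spec (.of Ω) ⟶ (P ⊗ (baseDiagram S).obj t).left) → Prop)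
    (hopen : ∀ x : ↥(P ⊗ (baseDiagram S).obj t).left,
      (∃ (Ω : Type u) (_ : Field Ω) (_ : IsAlgClosed Ω) (xb : Spec (.of Ω) ⟶ (P ⊗ (baseDiagram S).obj t).left),
          x ∈ Set.range xb ∧ Q Ω xb) →
        ∃ U : (P ⊗ (baseDiagram S).obj t).left.Opens, x ∈ U ∧
          ∀ (Ω : Type u) [Field Ω] [IsAlgClosed Ω] (yb : Spec (.of Ω) ⟶ (P ⊗ (baseDiagram S).obj t).left),
            Set.range yb ⊆ (U : Set _) → Q Ω yb)
    (hgen : ∀ (Ω : Type u) [Field Ω] [IsAlgClosed Ω] (yb : Spec (.of Ω) ⟶ (P ⊗ specOver A B).left),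
      Q Ω (yb ≫ (P ◁ leg S B t).left)) :
    ∃ (s : Idx S) (ρ : s ⟶ t), ∀ (Ω : Type u) [Field Ω] [IsAlgClosed Ω] (zb : Spec (.of Ω) ⟶ (P ⊗ (baseDiagram S).obj s).left),
      Q Ω (zb ≫ (P ◁ (baseDiagram S).map ρ).left) := by
  classical
  -- the union `W` of the opens all of whose geometric points satisfy `Q`
  let good : Set (P ⊗ (baseDiagram S).obj t).left.Opens := {U | ∀ (Ω : Type u) [Field Ω] [IsAlgClosed Ω]
    (yb : Spec (.of Ω) ⟶ (P ⊗ (baseDiagram S).obj t).left), Set.range yb ⊆ (U : Set _) → Q Ω yb}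
  let W : (P ⊗ (baseDiagram S).obj t).left.Opens := sSup good
  have hW : ∀ (Ω : Type u) [Field Ω] [IsAlgClosed Ω] (yb : Spec (.of Ω) ⟶ (P ⊗ (baseDiagram S).obj t).left),
      Set.range yb ⊆ (W : Set _) → Q Ω yb := by
    intro Ω _ _ yb hyb
    -- `Spec Ω` is one point; it lands in one member of the union
    let p : ↥(Spec (.of Ω)) := IsLocalRing.closedPoint Ω
    have hp : yb p ∈ W := hyb ⟨p, rfl⟩
    obtain ⟨U, hU, hpU⟩ := TopologicalSpace.Opens.mem_sSup.1 hp
    refine hU Ω yb ?_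
    rintro _ ⟨q, rfl⟩
    rw [Subsingleton.elim q p]
    exact hpU
  -- `W` contains the image of the generic base
  have hc : pullback.fst (𝟙 (P ⊗ (baseDiagram S).obj t).left) (P ◁ (baseCone S B).π.app t).left =
      pullback.snd (𝟙 (P ⊗ (baseDiagram S).obj t).left) (P ◁ (baseCone S B).π.app t).left ≫ (P ◁ (baseCone S B).π.app t).left := by
    rw [← pullback.condition, Category.comp_id]
  have hgenW : Set.range (pullback.fst (𝟙 (P ⊗ (baseDiagram S).obj t).left) (P ◁ (baseCone S B).π.app t).left) ⊆ (W : Set _) := by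
    rintro _ ⟨z, rfl⟩
    rw [hc, Scheme.Hom.comp_apply]
    -- a geometric point over `y := snd z`: the algebraic closure of its residue field
    let y : ↥(P ⊗ specOver A B).left :=
      pullback.snd (𝟙 (P ⊗ (baseDiagram S).obj t).left) (P ◁ (baseCone S B).π.app t).left z
    let Ω : Type u := AlgebraicClosure ((P ⊗ specOver A B).left.residueField y)
    let yb : Spec (.of Ω) ⟶ (P ⊗ specOver A B).left :=
      Spec.map (CommRingCat.ofHom (algebraMap ((P ⊗ specOver A B).left.residueField y) Ω)) ≫
        (P ⊗ specOver A B).left.fromSpecResidueField y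
    have hyb : yb (IsLocalRing.closedPoint Ω) = y := by
      change (Spec.map _ ≫ (P ⊗ specOver A B).left.fromSpecResidueField y) _ = y
      rw [Scheme.Hom.comp_apply, Scheme.fromSpecResidueField_apply]
    obtain ⟨U, hxU, hU⟩ := hopen ((P ◁ (baseCone S B).π.app t).left y) ⟨Ω, inferInstance, inferInstance,
      yb ≫ (P ◁ (baseCone S B).π.app t).left, ⟨IsLocalRing.closedPoint Ω, by rw [Scheme.Hom.comp_apply, hyb]; rfl⟩, hgen Ω yb⟩
    exact TopologicalSpace.Opens.mem_sSup.2 ⟨U, hU, hxU⟩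
  -- a finer stage lands in `W`
  haveI : QuasiCompact (Over.mk (𝟙 (P ⊗ (baseDiagram S).obj t).left)).hom := inferInstanceAs (QuasiCompact (𝟙 _))
  obtain ⟨s, ρ, hs⟩ := exists_stage_range_fst_subset (B := B) P (Over.mk (𝟙 (P ⊗ (baseDiagram S).obj t).left)) W hgenW
  refine ⟨s, ρ, fun Ω _ _ zb => hW Ω _ ?_⟩
  rintro _ ⟨q, rfl⟩
  refine hs ⟨pullback.lift (P ◁ (baseDiagram S).map ρ).left (𝟙 _) (by simp) (zb q), ?_⟩
  have e1 := Scheme.Hom.comp_apply (pullback.lift (P ◁ (baseDiagram S).map ρ).left (𝟙 (P ⊗ (baseDiagram S).obj s).left) (by simp))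
    (pullback.fst (𝟙 (P ⊗ (baseDiagram S).obj t).left) (P ◁ (baseDiagram S).map ρ).left) (zb q)
  rw [pullback.lift_fst] at e1
  rw [Scheme.Hom.comp_apply]
  exact e1.symm

end LocApprox

end Literature.AlgebraicGeometry.Limits

/-! ## §2 A homomorphism that is fibrewise `Λ(ample)` after base change is a polarization of the base change -/

namespace Literature.AlgebraicGeometry.AbelianSchemes

namespace AbelianSchemeOver

open Literature.AlgebraicGeometry.Motives Literature.AlgebraicGeometry.AbelianVarieties
open Literature.AlgebraicGeometry.Limits Literature.AlgebraicGeometry.Limits.LocApprox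

section BaseChange

variable {T T' : Scheme.{u}} (A₀ : AbelianSchemeOver T) (g : T' ⟶ T) (D : A₀.DualPair) (lam : A₀.X ⟶ D.hat.X) [IsMonHom lam]

/-- **`λ ×_T T′` IS A POLARIZATION as soon as `λ̄ = Λ(𝒪(Θ))` with `Θ` ample at every geometric point of the form `z̄ ≫ g`** (`z̄` a geometric point
of `T′`): `lam := λ ×_T T′` (a homomorphism, Mathlib `Functor.map.instIsMonHom`), ample witness `e^*Θ` at `z̄` (★ `IsLambdaOfAt.baseChange`,
`IsAmple.pullback` along the fibre identification) — the proof of ★ `Polarization.baseChange` read pointwise.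
[cite: MumfordFogartyKirwan1994, Ch. 6 §2 Definition 6.3 (p. 120) and Ch. 7 §2 Definition 7.2 (p. 129)] -/
theorem exists_polarization_baseChange_of_forall_isLambdaOfAt
    (h : ∀ (Ω : Type u) [Field Ω] [IsAlgClosed Ω] (zb : Spec (.of Ω) ⟶ T'),
      ∃ Θ : CartierDivisor (A₀.fibre (zb ≫ g)).toAbelianVariety.X.left, Θ.IsAmple ∧ A₀.IsLambdaOfAt (zb ≫ g) D lam Θ) :
    ∃ pol : (A₀.baseChange g).Polarization (D.baseChange g), pol.lam = (Over.pullback g).map lam := by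
  refine ⟨⟨(Over.pullback g).map lam, Functor.map.instIsMonHom _ _ lam, fun Ω _ _ zb => ?_⟩, rfl⟩
  obtain ⟨Θ, hΘ, hΛ⟩ := h Ω zb
  haveI := A₀.isIso_toSchemeHom_fibreBaseChangeIso g zb
  exact ⟨A₀.divisorBaseChange g zb Θ, hΘ.pullback _, IsLambdaOfAt.baseChange A₀ g D zb lam Θ hΛ⟩

end BaseChange

/-! ## §3 The (s2-λ)-ample head: generically a polarization ⇒ a polarization over a finer stage, given the open locus -/

section Stage

variable {A : Type u} [CommRing A] {S : Submonoid A} (B : Type u) [CommRing B] [Algebra A B] [IsLocalization S B]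
  {P : SchemeOver A} [QuasiCompact P.hom] {t : Idx S}
  (𝒜 : AbelianSchemeOver (P ⊗ (baseDiagram S).obj t).left) (D : 𝒜.DualPair) (lam : 𝒜.X ⟶ D.hat.X) [IsMonHom lam]

/-- **A HOMOMORPHISM `λ : 𝒜 → Â` OVER A STAGE BASE WHICH IS A POLARIZATION GENERICALLY IS A POLARIZATION OVER A FINER STAGE, GIVEN THE OPEN
LOCUS.**  `𝒜` an abelian scheme over `P ⊗ D(t)` (`P → Spec A` quasi-compact, `B = A_S`) with dual pair `D = (Â, 𝒫)` and a homomorphism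
`λ : 𝒜 → Â`; HYPOTHESES: (`hgen`) at every geometric point `ȳ ≫ (P ◁ π_t)` coming from the generic base, `λ̄ = Λ(𝒪(Θ))` for an ample `Θ`
(e.g. transported from a polarization of the generic base change); (`hopen`, BY VALUE = [GortzWedhorn2023] Cor. 27.285 for `λ`: «a polarization
at one geometric point over `x` ⇒ a polarization over an open neighbourhood of `x`»).  CONCLUSION: for some `ρ : s ⟶ t`, `λ ×_{P⊗D(t)} (P ⊗ D(s))`
underlies a ★ `Polarization` of `𝒜 ×_{P⊗D(t)} (P ⊗ D(s))` (★ `baseChange (stageOver ρ).hom`) for the base-changed dual pair.  §1 + §2.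
[cite: GortzWedhorn2023, Cor. 27.285 (p. 949)] [cite: MumfordFogartyKirwan1994, Ch. 6 §2 Definition 6.3 (p. 120)] [cite: StacksProject, Tag 01Z3] -/
theorem exists_stage_polarization_of_isOpen_locus
    (hopen : ∀ x : ↥(P ⊗ (baseDiagram S).obj t).left,
      (∃ (Ω : Type u) (_ : Field Ω) (_ : IsAlgClosed Ω) (xb : Spec (.of Ω) ⟶ (P ⊗ (baseDiagram S).obj t).left),
          x ∈ Set.range xb ∧ ∃ Θ : CartierDivisor (𝒜.fibre xb).toAbelianVariety.X.left, Θ.IsAmple ∧ 𝒜.IsLambdaOfAt xb D lam Θ) →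
        ∃ U : (P ⊗ (baseDiagram S).obj t).left.Opens, x ∈ U ∧
          ∀ (Ω : Type u) [Field Ω] [IsAlgClosed Ω] (yb : Spec (.of Ω) ⟶ (P ⊗ (baseDiagram S).obj t).left),
            Set.range yb ⊆ (U : Set _) →
              ∃ Θ : CartierDivisor (𝒜.fibre yb).toAbelianVariety.X.left, Θ.IsAmple ∧ 𝒜.IsLambdaOfAt yb D lam Θ)
    (hgen : ∀ (Ω : Type u) [Field Ω] [IsAlgClosed Ω] (yb : Spec (.of Ω) ⟶ (P ⊗ specOver A B).left),
      ∃ Θ : CartierDivisor (𝒜.fibre (yb ≫ (P ◁ leg S B t).left)).toAbelianVariety.X.left,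
        Θ.IsAmple ∧ 𝒜.IsLambdaOfAt (yb ≫ (P ◁ leg S B t).left) D lam Θ) :
    ∃ (s : Idx S) (ρ : s ⟶ t) (pol : (𝒜.baseChange (stageOver S P ρ).hom).Polarization (D.baseChange (stageOver S P ρ).hom)),
      pol.lam = (Over.pullback (stageOver S P ρ).hom).map lam := by
  obtain ⟨s, ρ, hs⟩ := exists_stage_forall_geometricPoint B P
    (fun Ω _ _ xb => ∃ Θ : CartierDivisor (𝒜.fibre xb).toAbelianVariety.X.left, Θ.IsAmple ∧ 𝒜.IsLambdaOfAt xb D lam Θ) hopen hgen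
  exact ⟨s, ρ, exists_polarization_baseChange_of_forall_isLambdaOfAt 𝒜 (stageOver S P ρ).hom D lam hs⟩

end Stage

end AbelianSchemeOver

end Literature.AlgebraicGeometry.AbelianSchemes

end
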